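import Literature.NumberTheory.EllipticCurves.KuriharaNumberInvariants
import Literature.NumberTheory.EllipticCurves.KuriharaNumberKimStructure
import Literature.NumberTheory.EllipticCurves.Tamagawa
import HarnessLib

/-!
# Büyükboduk 2009 Thm. B (the TAMAGAWA DEFECT of Kato's Kolyvagin system) read on Kurihara numbers through
# C.-H. Kim 2026 Thm. 3.13: every Kurihara number of `E` is divisible by `p^{ord_p c_ℓ}` for EACH single
# Tamagawa number `c_ℓ` — the ONE-PRIME (max) form of the `≥` half of the refined Kurihara conjecture
# (named fact, PUBLISHED ∘ PUBLISHED; nothing asserted)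

Topic `NumberTheory/EllipticCurves`, sub-directory `Buyukboduk2009` (namespace = path,
`Literature.NumberTheory.EllipticCurves.Buyukboduk2009`). ONE named fact (`def … : Prop`, D-0014) and
nothing else: no definition with computational content, no instance, no notation, no `_holds` (size XL:
Kato's Euler system, Mazur–Rubin Kolyvagin systems, Büyükboduk's cokernel computation, Kim's torsion
dual-exponential map — none of it is in Mathlib; Kato's Kolyvagin system `κ^{Kato}` is not a tree object).
Written for the cell `bsd-ssimc` (HOME `run/shared/lean/pub/bsd-ssimc/`; the programme assembles BSD for
analytic rank ≤ 1 STRICTLY from published theorems and TYPES the remainder — nothing here proves BSD),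
seat `bsd-line-slh-p1-w2` gen 6, route `SignedLowerHalves`, crux item stmt-BirchSwinnertonDyer-19001
`KobayashiLowerHalfLargeImage`, line of record `kurihara_rigidity`, registered stub
`stub_tamagawa_le_kuriharaPartialInfty_X7` (the `≥` half `ord_p ∏ c_ℓ ≤ ∂^{(∞)}(δ̃)` = the tree's
`X4.KimTamagawaDefectGeAt`), which is closed today only MODULO the PREPRINT reading
`CastellaSano2026_sec2_tamagawaDefectGe_implicit_OPEN` (`Summits/…/KobayashiMainConjectureKuriharaRigidity`,
p607714). This file records what IS in print: the contribution of ONE Tamagawa number (Büyükboduk: "the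
'improvement' we give above includes only one Tamagawa factor. A further improvement which shall include
all Tamagawa factors unfortunately escapes our method", p0003 L33) — the MAX form; the SUM form for
several Tamagawa-`p` carriers is Büyükboduk's open §4.2 Question 1–2 and is BARRED as a
Kolyvagin-system-only derivation by the catalogued barrier
`Literature.Barriers.BirchSwinnertonDyer.StringentKolyvaginCapsAtMax` (which this fact respects: it
certifies exactly `max_ℓ ord_p c_ℓ`). Consumer (kernel, Summits-side, same seat): the registered `≥` stub
VERBATIM on the sub-population «`ord_p ∏_ℓ c_ℓ(E) ≤ ord_p c_{ℓ₀}(E)` for some prime `ℓ₀`» (one carrier —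
the generic `p ∣ Tam` row), PRE → PUB there.

## The printed statements

(B09) K. Büyükboduk, *Tamagawa defect of Euler systems*, J. Number Theory 129 (2009) 402–417 =
arXiv:0710.3858 (held text `paper:arxiv-0710.3858`, page files `pNNNN.txt`):
* p0003 L20–L22: "the hypotheses of Theorem A hold when `T = T_p(E)`, i.e. when `T` is the `p`-adic
  Tate module of an elliptic curve `E_{/ℚ}` with conductor `N`. Let `κ^{Kato}` denote the Kolyvagin system
  obtained from Kato's Euler system, as in [mr02] 6.2. Let `c_ℓ` be the Tamagawa number of `E` at `ℓ`,
  and suppose `p^n ∣ c_ℓ`. **Theorem B.** `κ^{Kato} ∈ p^n KS(T)`."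
* §3, p0010 L63–L66 (standing hypotheses of the application): "Let `E_{/ℚ}` be an elliptic curve defined
  over `ℚ` and let `T = T_p(E)` … We will also assume that `p > 3`, the `p`-adic representation
  `G_ℚ → Aut(E[p^∞])` is surjective. Suppose the Tamagawa number `c_ℓ = |E(ℚ_ℓ)/E_0(ℚ_ℓ)|` at `ℓ ≠ p` is
  divisible by `p`, and set `n = ord_p(c_ℓ)`."
* p0011 L20–L28: "**Corollary 3.3.** Let `T = T_p(E), E, c_ℓ, n` be as above. Then
  `im(ES(T) → KS(T, F_can, P)) ⊂ p^n KS(T, F_can, P)`. … Kato [kato] has constructed an Euler system which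
  gives rise to a Kolyvagin system `κ^{Kato} ∈ KS(T, F_can, P)` for a suitably chosen set of primes `P`,
  see [ru98] 3.5 and [mr02] 6.2 … Corollary 3.3 shows that `κ^{Kato} ∈ p^n KS(T, F_can, P)`. Further we
  know … that `KS(T, F_can, P)` is a free `ℤ_p`-module of rank one, and is generated by a primitive
  Kolyvagin system. We fix such a generator `κ^E` so that `κ^{Kato} = p^α · κ^E` for some `α ≥ n`."

(K26) C.-H. Kim, *The structure of Selmer groups and the Iwasawa main conjecture for elliptic curves*,
Amer. J. Math. 148 (2026) 79–129 = arXiv:2203.12159 (held text `paper:arxiv-2203.12159`; arXiv numbering):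
* §1.2.2 / §1.4.3 (p0005, p0007): `𝒫_k`, `𝒩_k`, `I_n`, and `δ̃_n = ∑_{a ∈ (ℤ/n)ˣ} \overline{[a/n]⁺}
  ∏_{ℓ∣n} \overline{log_{η_ℓ}(a)} ∈ ℤ_p/I_nℤ_p` "well-defined up to `(ℤ_p/I_nℤ_p)ˣ`", `[r]⁺` normalised by
  the real Néron period `Ω⁺_E`; §1.3.5 (p0006 L85): the Manin constant enters only through this
  normalisation. §2.3.2 (p0012 L89–L95): "Kato's Kolyvagin system `κ^{Kato}` is defined by the image of
  `z^{Kato}` under the map in Theorem 2.1 (Mazur–Rubin)" — the Euler-to-Kolyvagin-system map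
  `ES(T, 𝒦, 𝒫) → KS(T, F_can, 𝒫)` (p0012 L54–L66, with the cyclicity hypothesis "`T/(Fr_ℓ − 1)T` is a
  cyclic `ℤ_p`-module for every `ℓ ∈ 𝒫`"), and `κ^{Kato}_n ∈ Sel_{rel,n}(ℚ, T/I_nT)` for `n ∈ 𝒩_1`.
* §3.2.1 (p0015 L120–L127): "`t = 0` if `E` has split multiplicative reduction at `p`,
  `length_{ℤ_p}(E(ℚ_p)[p^∞])` otherwise."
* **Theorem 3.13** (p0017 L130–L134), VERBATIM: "Let `E` be an elliptic curve over `ℚ` and `p ≥ 5` is a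
  prime such that `ρ̄` is surjective and the Manin constant is prime to `p`. Then we have formula
  `ι ∘ exp*_{ω_E} ∘ loc^s_p(κ^{Kato}_n) = u · p^t · δ̃_n ∈ ℤ_p/I_nℤ_p` where `u ∈ (ℤ_p/I_nℤ_p)ˣ`" — `ι` the
  fixed `ℤ_p`-module isomorphism of §3.4.1 (p0017 L118–L127), the map being defined on
  `Sel_{rel,n}(ℚ, T/I_nT)` (display (3.4.1)).

## The composition (three lines on paper; flag `B09K26-composition`)

For `ℓ ≠ p` prime with `n := ord_p c_ℓ ≥ 1`, under `p ≥ 5`, `ρ_{E,p^∞}` onto (hence `ρ̄` onto), Manin: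
(1) `κ^{Kato} = p^α κ^E` in the `ℤ_p`-module `KS(T, F_can, 𝒫) ⊆ ∏_m H¹_{F_can(m)}(ℚ, T/I_mT)` with
`α ≥ n` (B09 Cor. 3.3 + "fix such a generator"), so `κ^{Kato}_m = p^α κ^E_m` in `Sel_{rel,m}(ℚ, T/I_mT)`
for every level `m`; (2) applying the `ℤ_p`-linear map `ι ∘ exp* ∘ loc^s_p` of (K26) §3.4.1 and Thm.
3.13: `u · p^t · δ̃_m = p^α · (ι ∘ exp* ∘ loc^s_p)(κ^E_m) ∈ p^α (ℤ_p/I_mℤ_p)`; (3) `u` is a unit and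
`t = 0` when `E(ℚ_p)[p] = 0` (the `(t0)` binder below), hence `δ̃_m ∈ p^n (ℤ_p/I_mℤ_p)` for EVERY
`m ∈ 𝒩_1`: in Kim's notation `n ≤ ∂^{(i)}(δ̃)` for all `i`, i.e. `ord_p c_ℓ ≤ ∂^{(∞)}(δ̃)`. (When
`p ∤ c_ℓ` the conclusion `0 ≤ ∂^{(∞)}` is empty.) Both systems are Mazur–Rubin's `κ^{Kato}` ([mr02]
§6.2 = (K26) Thm. 2.1, flag `B09K26-same-KS`: B09's "suitably chosen `P`" and Kim's `𝒫_1` are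
Mazur–Rubin's set of Kolyvagin primes; the tree reads the conclusion on the CYCLIC levels
`IsCyclicKolyvaginLevel`, the levels of (K26) Thm. 2.1's cyclicity hypothesis, as every Kim-type fact
of the tree does — flag `Kim2026-(6)-cyclic-reading` of `KuriharaNumberKimStructure`).

## The fact below and its reading (weaker than print, never stronger; flags for the referee)

Frame: `W/ℚ` globally minimal elliptic; `5 ≤ p` (B09 `p > 3`, K26 `p ≥ 5`); `p` GOOD for `W` (so that
`(ℓ, Np) = 1` in `𝒫_1` is the tree's `Kato.IsKolyvaginPrime`, as in every sibling; B09/K26 Thm. 3.13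
need no reduction hypothesis at `p` — weaker fact); `ρ_{W,p^∞}` onto as `∀ m, HasSurjectiveModNGaloisRep
(p^m)` (B09's (surj-serre); it implies K26's "`ρ̄` surjective" at `m = 1`); the `(t0)` binder
`#W(ℚ_p)[p] = 1` typed EXACTLY as in the Kim twins (`Nat.card {Q : (W.baseChange ℚ_[p]).toAffine.Point //
p • Q = 0} = 1`; then `E(ℚ_p)[p^∞] = 0` and Kim's `t = 0`; automatic at a good supersingular `p ≥ 3`,
tree theorem `natCard_localPTorsion_eq_one_of_good_of_not_dvd_frobeniusTrace_sub_one`, where consumers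
discharge it); Kim's Manin hypothesis as the period-transfer clause `Ω(W) = u · Ω⁺_f`, `u ∈ ℚ`,
`|u|_p = 1` (reading `KR-period` of `KuriharaNumberKimCertificate` / `Kim2026.thm111_…`: under it the
tree's `Ω⁺_f`-normalised `kuriharaNumber f (p^k) n ψ` is a UNIT multiple of Kim's `δ̃^{(k)}_n`, so
"`δ̃_n ∈ p^j ℤ_p/I_nℤ_p`" is the tree's `KuriharaDivisibleAt W p f n j`, and `∂^{(∞)}(δ̃)` is
`kuriharaPartialInfty W p f` — module docstring of `KuriharaNumberInvariants`); `f` a newform of `W` at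
any level (`IsNewformOf W f`; Kim's modular symbols are those of the newform of `E`). The prime `ℓ`: any
prime `ℓ ≠ p`; `c_ℓ` is the tree's `(W.baseChange ℚ_[ℓ]).localTamagawaNumber ℤ_[ℓ]` (as in
`RaySujatha2023.cor27_…`). CONCLUSION: `(ord_p c_ℓ : ℕ∞) ≤ kuriharaPartialInfty W p f`. READING FLAGS:
`B09K26-composition` (the three-line composition above; neither `κ^{Kato}` nor `KS(T)` is a tree object,
exactly as the accepted `Kim2026.thm111_katoMainIdentity_of_kuriharaNumber_ne_zero` carries Kim's
`Λκ₁^{Kato,∞}` by a flag), `B09K26-same-KS`, `Kim2026-(6)-cyclic-reading`, `KR-period`. Everything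
recorded is implied by, never stronger than, the two printed theorems under these readings.

What this fact is NOT: not the SUM form `ord_p ∏_ℓ c_ℓ ≤ ∂^{(∞)}(δ̃)` for two or more Tamagawa-`p`
carriers (B09 §4.2 Questions 1–2, OPEN; barrier `StringentKolyvaginCapsAtMax`); not Kim's Conjecture
1.10 / Castella–Sano Conj. 2 (the `≤` half is the crux's HARD stub); not a statement at `p = 3` (B09
`p > 3`, K26 `p ≥ 5`), nor for a non-surjective `ρ_{W,p^∞}`, nor at a bad `p`.

## References

* K. Büyükboduk, J. Number Theory 129 (2009) 402–417 = arXiv:0710.3858: Thm. A/B (arXiv p. 2 = p0003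
  L15–L22), §3 hypotheses (p0010 L63–L66), Thm. 3.1, Cor. 3.3 and the paragraph after it (p0011 L20–L28),
  §4.2 Questions 1–2 (p0012). [Buyukboduk2009TamagawaDefect]
* C.-H. Kim, Amer. J. Math. 148 (2026) 79–129 = arXiv:2203.12159: §1.2.2, §1.3.5, §1.4.3, §1.5.1, Thm. 2.1
  (PDF p. 12), §2.3.2 (p. 12), §3.2.1 (p. 15), §3.4.1 and Thm. 3.13 (PDF p. 17). [Kim2022StructureSelmer]
* B. Mazur, K. Rubin, *Kolyvagin systems*, Mem. AMS 799 (2004), §3.1 (the module `KS`), Thm. 3.2.4, §6.2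
  (cite only). [MazurRubin2004]
* Barrier: `Literature/Barriers/BirchSwinnertonDyer/StringentKolyvaginCapsAtMax.lean` (MAX vs SUM).
-/

noncomputable section

open scoped Classical MatrixGroups ModularForm

open CongruenceSubgroup WeierstrassCurve Literature.NumberTheory.EllipticCurves
  Literature.NumberTheory.EllipticCurves.ModularForms Literature.NumberTheory.GaloisRepresentations

namespace Literature.NumberTheory.EllipticCurves.Buyukboduk2009

/-- **Büyükboduk 2009 Thm. B / Cor. 3.3 ∘ C.-H. Kim 2026 Thm. 3.13 — every Kurihara number of `E` is
divisible by `p^{ord_p c_ℓ}` for EACH prime `ℓ ≠ p`: `ord_p c_ℓ ≤ ∂^{(∞)}(δ̃)` (the one-prime / MAX form of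
the `≥` half of Kim's refined Tamagawa-defect identity for Kurihara numbers).** Printed inputs (module docstring, verbatim): (B09) "Let
`c_ℓ` be the Tamagawa number of `E` at `ℓ`, and suppose `p^n ∣ c_ℓ`. Theorem B. `κ^{Kato} ∈ p^n KS(T)`"
under "`p > 3`, the `p`-adic representation `G_ℚ → Aut(E[p^∞])` is surjective" (arXiv:0710.3858 p. 2 and
§3, Cor. 3.3: "`κ^{Kato} = p^α · κ^E` for some `α ≥ n`"); (K26) Thm. 3.13: "`p ≥ 5` … `ρ̄` is surjective and
the Manin constant is prime to `p`. Then `ι ∘ exp*_{ω_E} ∘ loc^s_p(κ^{Kato}_n) = u · p^t · δ̃_n ∈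
ℤ_p/I_nℤ_p` where `u ∈ (ℤ_p/I_nℤ_p)ˣ`", `t = length E(ℚ_p)[p^∞]` (§3.2.1). Composition (flag
`B09K26-composition`): `κ^{Kato}_m = p^α κ^E_m` at every level, the map of Thm. 3.13 is `ℤ_p`-linear,
`u` is a unit and `t = 0` under `(t0)`, so `δ̃_m ∈ p^{ord_p c_ℓ}(ℤ_p/I_mℤ_p)` for every `m ∈ 𝒩_1`.
Frame / binders, typed as in the Kim twins of the tree: `W/ℚ` globally minimal, `5 ≤ p` GOOD for `W`,
`ρ_{W,p^∞}` onto (`∀ m, HasSurjectiveModNGaloisRep (p^m)`), `(t0)` `#W(ℚ_p)[p] = 1`, the period transfer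
`Ω(W) = u·Ω⁺_f`, `|u|_p = 1` (Manin, reading `KR-period`), `f` a newform of `W`; `ℓ ≠ p` prime, `c_ℓ =
(W.baseChange ℚ_[ℓ]).localTamagawaNumber ℤ_[ℓ]`. CONCLUSION on the tree's invariants
(`KuriharaNumberInvariants`, cyclic levels — flag `Kim2026-(6)-cyclic-reading`):
`(padicValNat p c_ℓ : ℕ∞) ≤ kuriharaPartialInfty W p f`. NOT the sum over several `ℓ` (Büyükboduk §4.2
Questions 1–2 ask for it; barrier `StringentKolyvaginCapsAtMax`); silent at `p = 3`. Weaker than print; nothing asserted; no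
`_holds` (size XL).
[cite: Buyukboduk2009TamagawaDefect, Thm. B (arXiv:0710.3858 p. 2), §3 hypotheses (p. 10), Cor. 3.3 and the following paragraph (p. 11), §4.2 Questions 1–2 (p. 12)]
[cite: Kim2022StructureSelmer, Thm. 3.13 and §3.4.1 (PDF p. 17), §3.2.1 (PDF p. 15), Thm. 2.1 and §2.3.2 (PDF p. 12), §1.2.2, §1.3.5, §1.4.3, §1.5.1 (PDF pp. 5–7)]
[cite: MazurRubin2004, §3.1 and §6.2] -/
def thmB_via_kim313_padicValNat_localTamagawa_le_kuriharaPartialInfty : Prop :=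
  ∀ (W : WeierstrassCurve ℚ) [W.IsElliptic] [W.IsGloballyMinimal] (p : ℕ) [Fact p.Prime]
    {N : ℕ} [NeZero N] (f : CuspForm (Gamma0 N) 2),
  -- frame: `p ≥ 5` good, newform `f` of `W`
    5 ≤ p → W.HasGoodReductionAtPrime p → IsNewformOf W f →
  -- Büyükboduk's (surj-serre): `ρ_{W,p^∞}` onto (`⟹` Kim's `ρ̄` onto)
    (∀ m : ℕ, W.HasSurjectiveModNGaloisRep (p ^ m : ℕ)) →
  -- `(t0)`: `#W(ℚ_p)[p] = 1`, so Kim's `t = length E(ℚ_p)[p^∞] = 0`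
    Nat.card {Q : (W.baseChange ℚ_[p]).toAffine.Point // (p : ℕ) • Q = 0} = 1 →
  -- Kim's Manin hypothesis as the period transfer `Ω(W) = u·Ω⁺_f`, `|u|_p = 1`
    (∃ u : ℚ, ‖(u : ℚ_[p])‖ = 1 ∧ W.realPeriodRat = u * plusPeriod f) →
  -- conclusion: for EACH prime `ℓ ≠ p`, `ord_p c_ℓ ≤ ∂^{(∞)}(δ̃)`
  ∀ (ℓ : ℕ) (_ : Fact ℓ.Prime), ℓ ≠ p →
    (padicValNat p ((W.baseChange ℚ_[ℓ]).localTamagawaNumber ℤ_[ℓ]) : ℕ∞) ≤ kuriharaPartialInfty W p f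

end Literature.NumberTheory.EllipticCurves.Buyukboduk2009

end
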